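import Summits.AtomisticToContinuum.Crystallization.Theorems.DisclinationRationUniformPolytypeStabilityDefs

/-!
# `UniformPolytypeStability` (stmt-AtomisticToContinuum-15800), line `birth` (v2, cells): stub `stub_gapPinning`, part 1 (definitions)

Route `DisclinationRation`, crux `UniformPolytypeStability`, line `birth` (lead prover-line-stmt-AtomisticToContinuum-15800-0).
The registered stub `stub_gapPinning : ∀ a s z, 47/50 ≤ a → a ≤ 1 → IsHaggSeq s → HeightBox a z → ForceBalanced a s z →
GapsPinned z` (all interlayer gaps of a force-balanced layered Lennard-Jones polytype in the box agree to `1/500`) is proved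
in the files `…GapPinning*.lean` along the idea card `Ideas/constant-stress-gap-pinning.md`:

* (B0) per-site force balance ⇒ the normal stress `P m = Σ_{i ≤ m < j} f(i,j)` transmitted across the plane between layers
  `m` and `m+1` is independent of `m` (`f(i,j)` = normal force per site that layer `i` exerts on layer `j`, a 2D lattice sum);
* (B1) the adjacent-layer part `𝒢₁(a, h_m/a)` of `P m` is strictly increasing in the gap with a certified slope `c₀(a)`;
* (B2) the remainder is gap-Lipschitz (`ℓ(a) < c₀(a)`) and blind to the stacking word up to `osc`; the bootstrap
  `c₀ Δ ≤ ℓ Δ + osc` pins the gap spread `Δ ≤ osc/(c₀ − ℓ) ≤ 1/500`.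

This file holds ALL definitions of that development (the later files are theorem-only):

1. the computable certificate machinery over `ℚ`/`ℤ` (truncated lattice sums `Σ_{|u|,|v| ≤ N} (Qf c (u,v) + η²)^{-k}`
   rounded DOWN to fixed point `2⁶⁰` at rational grid points `η`, monotone enclosures on cells, the per-cell slope /
   Lipschitz / word-oscillation bounds, the analytic tail constants, and the final Boolean `finalCheck`), evaluated ONCE by
   `native_decide` in `…GapPinningCert.lean`;
2. the real-analytic objects (`psi = V′(√x)/√x`, the lattice sums `Alat k c η`, their truncations `SN`, the layer-pair force
   `𝒢 = calG`, its truncation `FN` and derivative `FNd`, the layer-pair force `lf a s z i j` of the configuration, the rows and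
   the transmitted stress `Pst`, the normalised gaps `etaG` and their spread).

Conventions: `η = D/a` is a height difference in units of the in-plane spacing `a`; the in-plane offset `u v₁ + v v₂ + c w`
(`w = barlowOffset a = (v₁+v₂)/3`) has `‖·‖² = a² · Qf c (u,v)`; `V′(r)/r = −r⁻¹⁴ + r⁻⁸ = psi (r²)` and
`D · psi (a² (Qf + η²)) = η (a⁻⁷ (Qf+η²)⁻⁴ − a⁻¹³ (Qf+η²)⁻⁷)`.  Junk values: `x⁻¹ = 0` at `x = 0` (Lean), irrelevant on the
box (all arguments are `≥ 1/3`); `covers _ _ [] = false`; `c0Of` of an empty cell list is the dummy cap `1000`.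
Everything is `[folklore]` line-internal bookkeeping; nothing here closes an item.  `stub_gapPinningAux1` is the registered anchor.
-/

namespace Summit.AtomisticToContinuum.Crystallization.Theorems.UniformPolytypeStabilityCells

open Literature.MathematicalPhysics.StatisticalMechanics

namespace StubGapPinning

/-! ## Part 1: computable certificate machinery (exact `ℚ` / `ℤ` arithmetic) -/

/-- The in-plane quadratic form of the offset `u v₁ + v v₂ + c w` in units of `a²`:
`Qf c (u,v) = u² + uv + v² + c(u+v) + c²/3`, so that
`dist(pos (i,i₀,j₀), pos (j,i₀+u,j₀+v))² = a² · Qf (haggLabel s j − haggLabel s i) (u,v) + (z j − z i)²`. [folklore] -/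
def Qf (c : ℤ) (p : ℤ × ℤ) : ℚ :=
  (p.1 : ℚ) ^ 2 + (p.1 : ℚ) * p.2 + (p.2 : ℚ) ^ 2 + (c : ℚ) * (p.1 + p.2) + (c : ℚ) ^ 2 / 3

/-- The integer range `[-N, N]` as a computable `Finset` (image of `range (2N+1)` under `i ↦ i − N`). [folklore] -/
def rng (N : ℕ) : Finset ℤ :=
  (Finset.range (2 * N + 1)).map ⟨fun i : ℕ => (i : ℤ) - N, fun i j h => by simpa using h⟩

/-- The square truncation box `[-N, N]²` of in-plane indices. [folklore] -/
def box (N : ℕ) : Finset (ℤ × ℤ) := rng N ×ˢ rng N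

/-- The square ring index `max(|u|,|v|)` of an in-plane index. [folklore] -/
def sqRing (p : ℤ × ℤ) : ℕ := max p.1.natAbs p.2.natAbs

/-- The square shell `{max(|u|,|v|) = n}` (`8n` points for `n ≥ 1`). [folklore] -/
def shell (n : ℕ) : Finset (ℤ × ℤ) := (box n).filter fun p => sqRing p = n

/-- The coset class of `c w + Λ`: `0` if `3 ∣ c` (the layer pair is in `Λ`-registry), else `1` (`±w`-registry). [folklore] -/
def cls (c : ℤ) : ℤ := if 3 ∣ c then 0 else 1

/-- Fixed-point scale of the certificate, `2⁶⁰`. [folklore] -/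
def Mfp : ℕ := 2 ^ 60

/-- Fixed-point LOWER bound of `Mfp · Σ_{p ∈ box N} (Qf c p + e²)^{-k}`: every term is rounded down, so
`sumLo ≤ Mfp · SN k N c e ≤ sumLo + (2N+1)²`. [folklore] -/
def sumLo (k N : ℕ) (c : ℤ) (e : ℚ) : ℤ :=
  ∑ p ∈ box N, ⌊(Mfp : ℚ) * ((Qf c p + e ^ 2)⁻¹) ^ k⌋

/-- Grid-point record: a rational grid point `e` with its eight fixed-point lower sums `sumLo k N c e`,
`c ∈ {0,1}`, `k ∈ {4,5,7,8}` (computed once, shared by the two adjacent cells). [folklore] -/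
structure GV where
  /-- the grid point `e`. -/
  e : ℚ
  /-- `sumLo 4 N 0 e`. -/
  s04 : ℤ
  /-- `sumLo 5 N 0 e`. -/
  s05 : ℤ
  /-- `sumLo 7 N 0 e`. -/
  s07 : ℤ
  /-- `sumLo 8 N 0 e`. -/
  s08 : ℤ
  /-- `sumLo 4 N 1 e`. -/
  s14 : ℤ
  /-- `sumLo 5 N 1 e`. -/
  s15 : ℤ
  /-- `sumLo 7 N 1 e`. -/
  s17 : ℤ
  /-- `sumLo 8 N 1 e`. -/
  s18 : ℤ

/-- The grid-point record of `e` at truncation `N`. [folklore] -/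
def mkGV (N : ℕ) (e : ℚ) : GV :=
  ⟨e, sumLo 4 N 0 e, sumLo 5 N 0 e, sumLo 7 N 0 e, sumLo 8 N 0 e,
    sumLo 4 N 1 e, sumLo 5 N 1 e, sumLo 7 N 1 e, sumLo 8 N 1 e⟩

/-- Field access `(mkGV N e).s c k = sumLo k N c e` for `c ∈ {0,1}`, `k ∈ {4,5,7,8}`. [folklore] -/
def GV.s (g : GV) (c : ℤ) (k : ℕ) : ℤ :=
  if c = 0 then (if k = 4 then g.s04 else if k = 5 then g.s05 else if k = 7 then g.s07 else g.s08)
  else (if k = 4 then g.s14 else if k = 5 then g.s15 else if k = 7 then g.s17 else g.s18)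

/-- The uniform grid `lo, lo + (hi-lo)/n, …, hi` (`n+1` points). [folklore] -/
def grid (lo hi : ℚ) (n : ℕ) : List ℚ :=
  (List.range (n + 1)).map fun i => lo + (hi - lo) * (i : ℚ) / (n : ℚ)

/-- Consecutive pairs of a list (the cells of a grid). [folklore] -/
def pairs {α : Type*} : List α → List (α × α)
  | a :: b :: l => (a, b) :: pairs (b :: l)
  | _ => []

/-- The cells of `[lo, hi]` at truncation `N`: consecutive pairs of grid-point records. [folklore] -/
def cellsGV (N : ℕ) (lo hi : ℚ) (n : ℕ) : List (GV × GV) := pairs ((grid lo hi n).map (mkGV N))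

/-- The rational endpoints of a list of cells. [folklore] -/
def cellsQ (cs : List (GV × GV)) : List (ℚ × ℚ) := cs.map fun g => (g.1.e, g.2.e)

/-- `covers lo hi L`: the consecutive intervals of `L` cover `[lo, hi]` (checked left to right). [folklore] -/
def covers (lo hi : ℚ) : List (ℚ × ℚ) → Bool
  | [] => false
  | [c] => decide (c.1 ≤ lo ∧ hi ≤ c.2)
  | c :: c' :: l => decide (c.1 ≤ lo) && covers c.2 hi (c' :: l)

/-- Number of terms `(2N+1)²` of `box N`, as a rational. [folklore] -/
def cardB (N : ℕ) : ℚ := (((2 * N + 1) ^ 2 : ℕ) : ℚ)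

/-- Lower enclosure of `SN k N c η` on a cell, from its RIGHT endpoint record `g₂` (the sums decrease in `η`). [folklore] -/
def slo (g₂ : GV) (c : ℤ) (k : ℕ) : ℚ := (g₂.s c k : ℚ) / Mfp

/-- Upper enclosure of `SN k N c η` on a cell, from its LEFT endpoint record `g₁`. [folklore] -/
def shi (N : ℕ) (g₁ : GV) (c : ℤ) (k : ℕ) : ℚ := ((g₁.s c k : ℚ) + cardB N) / Mfp

/-- Lower enclosure of `X = SN 4 − 8η² SN 5` on the cell `(g₁, g₂)`. [folklore] -/
def Xlo (N : ℕ) (g₁ g₂ : GV) (c : ℤ) : ℚ := slo g₂ c 4 - 8 * g₂.e ^ 2 * shi N g₁ c 5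

/-- Upper enclosure of `X = SN 4 − 8η² SN 5` on the cell `(g₁, g₂)`. [folklore] -/
def Xhi (N : ℕ) (g₁ g₂ : GV) (c : ℤ) : ℚ := shi N g₁ c 4 - 8 * g₁.e ^ 2 * slo g₂ c 5

/-- Lower enclosure of `Y = SN 7 − 14η² SN 8` on the cell `(g₁, g₂)`. [folklore] -/
def Ylo (N : ℕ) (g₁ g₂ : GV) (c : ℤ) : ℚ := slo g₂ c 7 - 14 * g₂.e ^ 2 * shi N g₁ c 8

/-- Upper enclosure of `Y = SN 7 − 14η² SN 8` on the cell `(g₁, g₂)`. [folklore] -/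
def Yhi (N : ℕ) (g₁ g₂ : GV) (c : ℤ) : ℚ := shi N g₁ c 7 - 14 * g₁.e ^ 2 * slo g₂ c 8

/-- A cell is well formed: `0 < e₁ ≤ e₂`. [folklore] -/
def cellOK (g : GV × GV) : Bool := decide (0 < g.1.e ∧ g.1.e ≤ g.2.e)

/-- Slope cell test (level `t = 1`, class `1`): `Y ≤ 0` on the cell and the slope numerator
`a₂⁻⁶ (−Yhi) + Xlo ≥ 0` (`ia₂ = a₂⁻¹`). [folklore] -/
def slopeOK (ia₂ : ℚ) (N : ℕ) (g : GV × GV) : Bool :=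
  decide (Yhi N g.1 g.2 1 ≤ 0 ∧ 0 ≤ ia₂ ^ 6 * (-Yhi N g.1 g.2 1) + Xlo N g.1 g.2 1)

/-- Certified slope floor of `FN N 1 a` on the cell, valid for all `0 < a ≤ a₂`. [folklore] -/
def slopeVal (ia₂ : ℚ) (N : ℕ) (g : GV × GV) : ℚ :=
  ia₂ ^ 7 * (ia₂ ^ 6 * (-Yhi N g.1 g.2 1) + Xlo N g.1 g.2 1)

/-- Certified slope floor `c₀(a₂)` over a list of cells (dummy cap `1000`). [folklore] -/
def c0Of (ia₂ : ℚ) (N : ℕ) (cs : List (GV × GV)) : ℚ :=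
  cs.foldr (fun g acc => min (slopeVal ia₂ N g) acc) 1000

/-- Lower end of the product of the intervals `[alo, ahi] · [blo, bhi]`. [folklore] -/
def imulLo (alo ahi blo bhi : ℚ) : ℚ := min (min (alo * blo) (alo * bhi)) (min (ahi * blo) (ahi * bhi))

/-- Upper end of the product of the intervals `[alo, ahi] · [blo, bhi]`. [folklore] -/
def imulHi (alo ahi blo bhi : ℚ) : ℚ := max (max (alo * blo) (alo * bhi)) (max (ahi * blo) (ahi * bhi))

/-- Certified bound of `|FNd N c a η| = |a⁻⁷ (X − a⁻⁶ Y)|` on the cell for `a ∈ [a₁, a₂]`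
(`ia₁ = a₁⁻¹`, `ia₂ = a₂⁻¹`). [folklore] -/
def lipCell (ia₁ ia₂ : ℚ) (N : ℕ) (g : GV × GV) (c : ℤ) : ℚ :=
  ia₁ ^ 7 * max (|Xlo N g.1 g.2 c - imulHi (ia₂ ^ 6) (ia₁ ^ 6) (Ylo N g.1 g.2 c) (Yhi N g.1 g.2 c)|)
    (|Xhi N g.1 g.2 c - imulLo (ia₂ ^ 6) (ia₁ ^ 6) (Ylo N g.1 g.2 c) (Yhi N g.1 g.2 c)|)

/-- Certified Lipschitz constant of `FN N c a` (both classes) over a list of cells. [folklore] -/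
def LOf (ia₁ ia₂ : ℚ) (N : ℕ) (cs : List (GV × GV)) : ℚ :=
  cs.foldr (fun g acc => max (max (lipCell ia₁ ia₂ N g 0) (lipCell ia₁ ia₂ N g 1)) acc) 0

/-- Lower enclosure of the class difference `SN k N 0 e₁ − SN k N 1 e₁` AT the left endpoint. [folklore] -/
def dlo (N : ℕ) (g₁ : GV) (k : ℕ) : ℚ := ((g₁.s 0 k : ℚ) - g₁.s 1 k - cardB N) / Mfp

/-- Upper enclosure of the class difference `SN k N 0 e₁ − SN k N 1 e₁` AT the left endpoint. [folklore] -/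
def dhi (N : ℕ) (g₁ : GV) (k : ℕ) : ℚ := ((g₁.s 0 k : ℚ) - g₁.s 1 k + cardB N) / Mfp

/-- Bound of `|SN k N 0 η − SN k N 1 η|` over the whole cell (monotone enclosures). [folklore] -/
def dsup (N : ℕ) (g₁ g₂ : GV) (k : ℕ) : ℚ :=
  max (|slo g₂ 0 k - shi N g₁ 1 k|) (|shi N g₁ 0 k - slo g₂ 1 k|)

/-- Certified bound of the word oscillation `|FN N 0 a η − FN N 1 a η|` on the cell for `a ∈ [a₁, a₂]`:
value at the left endpoint plus (derivative bound) × (cell width). [folklore] -/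
def oscCell (ia₁ ia₂ : ℚ) (N : ℕ) (g : GV × GV) : ℚ :=
  g.1.e * ia₁ ^ 7 * max (|dlo N g.1 4 - imulHi (ia₂ ^ 6) (ia₁ ^ 6) (dlo N g.1 7) (dhi N g.1 7)|)
      (|dhi N g.1 4 - imulLo (ia₂ ^ 6) (ia₁ ^ 6) (dlo N g.1 7) (dhi N g.1 7)|) +
    (ia₁ ^ 7 * (dsup N g.1 g.2 4 + 8 * g.2.e ^ 2 * dsup N g.1 g.2 5) +
      ia₁ ^ 13 * (dsup N g.1 g.2 7 + 14 * g.2.e ^ 2 * dsup N g.1 g.2 8)) * (g.2.e - g.1.e)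

/-- Certified word oscillation over a list of cells. [folklore] -/
def oscOf (ia₁ ia₂ : ℚ) (N : ℕ) (cs : List (GV × GV)) : ℚ :=
  cs.foldr (fun g acc => max (oscCell ia₁ ia₂ N g) acc) 0

/-- Telescoping constant `β n = 32n/(18n − 15)` of the shell-tail bound. [folklore] -/
def betaC (n : ℕ) : ℚ := 32 * n / (18 * n - 15)

/-- Tail bound `Σ_{p ∉ box N} (Qf c p + e²)^{-k} ≤ tauB N e` (`k ≥ 4`, `N ≥ 1`, `|c| ≤ 1`). [folklore] -/
def tauB (N : ℕ) (e : ℚ) : ℚ := betaC (N + 1) / (3 / 4 * ((N : ℚ) - 1 / 3) ^ 2 + e ^ 2) ^ 3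

/-- The `η`-interval of level `t`: `η = (z (i+t) − z i)/a ∈ [39t/50, 17t/20]` on the box. [folklore] -/
def It (t : ℕ) : ℚ × ℚ := (39 * (t : ℚ) / 50, 17 * (t : ℚ) / 20)

/-- Truncation error of `calG` at level `t`: `|calG c a η − FN N c a η| ≤ tauT` for `η ∈ It t`, `a ≥ a₁`. [folklore] -/
def tauT (ia₁ : ℚ) (N t : ℕ) : ℚ := (It t).2 * ia₁ ^ 13 * tauB N (It t).1

/-- The constant `C₆` with `Alat 4 c η ≤ C₆ η⁻⁶` for `η ≥ 39(T+1)/50` (box `N = 3` plus shell tail). [folklore] -/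
def C6 (T : ℕ) : ℚ := 49 / (It (T + 1)).1 ^ 2 + betaC 4

/-- The far tail `Σ_{t > T} 2t · sup |row|`-bound `2 K a₁⁻⁷ / (3T³)`, `K = (17/20)(50/39)⁶ C₆`. [folklore] -/
def tailT (ia₁ : ℚ) (T : ℕ) : ℚ :=
  2 * ((17 : ℚ) / 20 * ((50 : ℚ) / 39) ^ 6 * C6 T) * ia₁ ^ 7 / (3 * (T : ℚ) ^ 3)

/-- Certificate parameters: truncation/cell numbers of level `1`, the last certified level `T`, the truncation and
cell numbers of levels `2 … T`, and the `a`-cells. [folklore] -/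
structure Prm where
  /-- truncation of level `1`. -/
  N1 : ℕ
  /-- number of cells of level `1`. -/
  n1 : ℕ
  /-- last certified level. -/
  T : ℕ
  /-- truncation of level `t`. -/
  Nt : ℕ → ℕ
  /-- number of cells of level `t`. -/
  nt : ℕ → ℕ
  /-- the `a`-cells covering `[47/50, 1]`. -/
  acells : List (ℚ × ℚ)

/-- The cells of level `t ≥ 2`. [folklore] -/
def cellsT (P : Prm) (t : ℕ) : List (GV × GV) := cellsGV (P.Nt t) (It t).1 (It t).2 (P.nt t)

/-- The cells of level `1`. [folklore] -/
def cells1 (P : Prm) : List (GV × GV) := cellsGV P.N1 (It 1).1 (It 1).2 P.n1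

/-- Certified Lipschitz constant of level `t`. [folklore] -/
def LT (P : Prm) (ia₁ ia₂ : ℚ) (t : ℕ) : ℚ := LOf ia₁ ia₂ (P.Nt t) (cellsT P t)

/-- Certified word oscillation of level `t`. [folklore] -/
def oscT (P : Prm) (ia₁ ia₂ : ℚ) (t : ℕ) : ℚ := oscOf ia₁ ia₂ (P.Nt t) (cellsT P t)

/-- Materialised level data `[(t, cellsT P t) | t = 2 … T]` (so that the lattice sums are evaluated once). [folklore] -/
def tData (P : Prm) : List (ℕ × List (GV × GV)) := (List.range (P.T - 1)).map fun i => (i + 2, cellsT P (i + 2))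

/-- `ℓ = Σ_{t=2}^{T} t² L_t` from the materialised data. [folklore] -/
def ellOf (P : Prm) (ia₁ ia₂ : ℚ) (td : List (ℕ × List (GV × GV))) : ℚ :=
  (td.map fun d => (d.1 : ℚ) ^ 2 * LOf ia₁ ia₂ (P.Nt d.1) d.2).sum

/-- `E = Σ_{t=2}^{T} t (osc_t + 2 τ_t) + tail` from the materialised data. [folklore] -/
def EOf (P : Prm) (ia₁ ia₂ : ℚ) (td : List (ℕ × List (GV × GV))) : ℚ :=
  (td.map fun d => (d.1 : ℚ) * (oscOf ia₁ ia₂ (P.Nt d.1) d.2 + 2 * tauT ia₁ (P.Nt d.1) d.1)).sum + tailT ia₁ P.T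

/-- The final inequality on one `a`-cell `[ac.1, ac.2]`: `500 (2τ₁ + E) ≤ c₀ − ℓ`. [folklore] -/
def aCellOK (P : Prm) (s1 : List (GV × GV)) (td : List (ℕ × List (GV × GV))) (ac : ℚ × ℚ) : Bool :=
  decide (0 < ac.1 ∧ ac.1 ≤ ac.2 ∧ ac.2 ≤ 1) && (s1.all (slopeOK ac.2⁻¹ P.N1)) &&
    decide (500 * (2 * tauT ac.1⁻¹ P.N1 1 + EOf P ac.1⁻¹ ac.2⁻¹ td) ≤ c0Of ac.2⁻¹ P.N1 s1 - ellOf P ac.1⁻¹ ac.2⁻¹ td)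

/-- THE CERTIFICATE: well-formedness and coverage of all cells, and the final inequality on every `a`-cell. [folklore] -/
def finalCheck (P : Prm) : Bool :=
  let s1 := cells1 P
  let td := tData P
  decide (2 ≤ P.T ∧ 1 ≤ P.N1) && covers (It 1).1 (It 1).2 (cellsQ s1) && s1.all cellOK &&
    td.all (fun d => decide (1 ≤ P.Nt d.1) && covers (It d.1).1 (It d.1).2 (cellsQ d.2) && d.2.all cellOK) &&
    covers (47 / 50) 1 P.acells && P.acells.all (aCellOK P s1 td)

/-- The parameters used by the line: level `1` truncated at `N = 7` with `60` cells, levels `2 … 16` truncated at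
`N = 10 … 15` with `48 … 2` cells, six `a`-cells of width `1/100`. [folklore] -/
def prm0 : Prm where
  N1 := 7
  n1 := 60
  T := 16
  Nt t := if t ≤ 2 then 10 else if t ≤ 4 then 12 else if t ≤ 6 then 13 else if t ≤ 8 then 14 else 15
  nt t := if t ≤ 2 then 48 else if t ≤ 3 then 16 else if t ≤ 4 then 10 else if t ≤ 5 then 6 else if t ≤ 6 then 5
    else if t ≤ 7 then 4 else if t ≤ 9 then 3 else 2
  acells := [(47 / 50, 19 / 20), (19 / 20, 24 / 25), (24 / 25, 97 / 100), (97 / 100, 49 / 50), (49 / 50, 99 / 100),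
    (99 / 100, 1)]

/-! ## Part 2: the real-analytic objects -/

noncomputable section

/-- `psi x = −x⁻⁷ + x⁻⁴`, so that `V′(r)/r = psi (r²)` for the Lennard-Jones potential (`r ≠ 0`). [folklore] -/
def psi (x : ℝ) : ℝ := -(x⁻¹) ^ 7 + (x⁻¹) ^ 4

/-- The 2D lattice sum `Alat k c η = Σ_{p ∈ ℤ²} (Qf c p + η²)^{-k}`. [folklore] -/
def Alat (k : ℕ) (c : ℤ) (η : ℝ) : ℝ := ∑' p : ℤ × ℤ, ((Qf c p : ℝ) + η ^ 2)⁻¹ ^ k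

/-- Its square truncation `SN k N c η = Σ_{p ∈ box N} (Qf c p + η²)^{-k}`. [folklore] -/
def SN (k N : ℕ) (c : ℤ) (η : ℝ) : ℝ := ∑ p ∈ box N, ((Qf c p : ℝ) + η ^ 2)⁻¹ ^ k

/-- The layer-pair normal force per site at spacing `a`, registry class `c`, reduced height `η = D/a`:
`calG c a η = η (a⁻⁷ Alat 4 c η − a⁻¹³ Alat 7 c η)` (`= D Σ_x V′(r_x)/r_x`). [folklore] -/
def calG (c : ℤ) (a η : ℝ) : ℝ := η * ((a⁻¹) ^ 7 * Alat 4 c η - (a⁻¹) ^ 13 * Alat 7 c η)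

/-- Its truncation `FN N c a η = η (a⁻⁷ SN 4 N c η − a⁻¹³ SN 7 N c η)`. [folklore] -/
def FN (N : ℕ) (c : ℤ) (a η : ℝ) : ℝ := η * ((a⁻¹) ^ 7 * SN 4 N c η - (a⁻¹) ^ 13 * SN 7 N c η)

/-- The `η`-derivative of `FN`: `a⁻⁷ (SN 4 − 8η² SN 5) − a⁻¹³ (SN 7 − 14 η² SN 8)`. [folklore] -/
def FNd (N : ℕ) (c : ℤ) (a η : ℝ) : ℝ :=
  (a⁻¹) ^ 7 * (SN 4 N c η - 8 * η ^ 2 * SN 5 N c η) - (a⁻¹) ^ 13 * (SN 7 N c η - 14 * η ^ 2 * SN 8 N c η)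

/-- The normal force per site that layer `i` exerts on layer `j` in the configuration `L(a,s,z)`
(third component of `Σ_{q ∈ layer i} (V′(|p−q|)/|p−q|) (p − q)` for any `p ∈ layer j`). [folklore] -/
def lf (a : ℝ) (s : ℤ → ℤ) (z : ℤ → ℝ) (i j : ℤ) : ℝ :=
  (z j - z i) * ∑' p : ℤ × ℤ, psi (a ^ 2 * (Qf (haggLabel s i - haggLabel s j) p : ℝ) + (z j - z i) ^ 2)

/-- Row `t` of the transmitted stress across the plane above layer `m`: `Σ_{k < t} lf (m−k) (m−k+t)`. [folklore] -/
def row (a : ℝ) (s : ℤ → ℤ) (z : ℤ → ℝ) (m : ℤ) (t : ℕ) : ℝ :=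
  ∑ k ∈ Finset.range t, lf a s z (m - k) (m - k + t)

/-- The transmitted normal stress `Pst m = Σ_{i ≤ m < j} lf i j = Σ_t row m t`. [folklore] -/
def Pst (a : ℝ) (s : ℤ → ℤ) (z : ℤ → ℝ) (m : ℤ) : ℝ := ∑' t : ℕ, row a s z m t

/-- The reduced gap `η_k = (z (k+1) − z k)/a`. [folklore] -/
def etaG (a : ℝ) (z : ℤ → ℝ) (k : ℤ) : ℝ := gap z k / a

/-- The spread of the reduced gaps `Δ = sup_{k,k'} |η_k − η_k'|`. [folklore] -/
def spread (a : ℝ) (z : ℤ → ℝ) : ℝ := ⨆ kk : ℤ × ℤ, |etaG a z kk.1 - etaG a z kk.2|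

end

end StubGapPinning

/-- Registered anchor `stub_gapPinningAux1` of the definitions file of `stub_gapPinning`: unit tests of the in-plane
form (`‖w‖² = a²/3`), the class map and the telescoping constant. [folklore] -/
theorem stub_gapPinningAux1 : StubGapPinning.Qf 1 (0, 0) = 1 / 3 ∧ StubGapPinning.cls 3 = 0 ∧
    StubGapPinning.cls 2 = 1 ∧ StubGapPinning.betaC 4 = 128 / 57 := by
  refine ⟨by norm_num [StubGapPinning.Qf], by decide, by decide, by norm_num [StubGapPinning.betaC]⟩

end Summit.AtomisticToContinuum.Crystallization.Theorems.UniformPolytypeStabilityCells
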